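import Summits.RiemannHypothesis.RiemannHypothesis.Theorems.HandoffVerifiedGramKernel
import Literature.NumberTheory.LFunctions.RiemannSiegelStirling
import Literature.NumberTheory.LFunctions.WeilSemilocalNegative
import HarnessLib

/-!
# The reach ceiling of the zero-side transfer (handoff prove-1, ATTEMPT-19, THEOREM R)

THEOREM V (`weilPositivityOn_of_rhUpTo_of_nearNullSamplingK`) turns a verified height `T₀` of RH plus
the near-null sampling hypothesis `NearNullSamplingK a φ T₀ h c θ p D k` (`τ_φ ‖g‖₂² ≤ 𝒱_φ(g) + c·M_φ(g)`
for every window test) into Weil positivity on `[-a, a]`, for a split kernel `φ` with transparency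
`θ` below the infrared height `|h|`, polar defect `p`, strip decay `(D, k)` and the margin condition
`L + c ≤ Re ψ(1/4 + ih/2)` (`L = log π + 2 S(2a + δ)` there; `L` is abstract here, so tapered margins
are covered).  This file proves, with NO hypothesis on the zeros of `ζ`, that these hypotheses cannot
be met beyond a reach dictated by `T₀`:
* `highMassK_le_band_add_tail` (R1): `M_φ(g) ≤ θ·B_h(g) + (‖g‖₂² - B_h(g))`, `B_h` the line mass of
  `ĝ` on `|t| < |h|` (Plancherel);
* `sq_strip_decay_ge_of_transparency` (R2): transparency below `|h|` against strip decay at `t = |h|`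
  forces `(1 - θ)|h|^{2k+2} ≤ D²`, hence a FLOOR under the split tariff (`splitTariff_ge_floor`);
* `reach_inequality` (THEOREM R): for `c ≥ 0` and every window test `g`,
  `min(κ_a |h|^{2k+2}/T₀^{2k}, L - Re ψ(1/4)) · ‖g‖₂² ≤ 𝒱_φ(g) + c·(‖g‖₂² - B_h(g))`,
  `κ_a = 8 log 2 · A₁ · a e^a`: the verified zeros must see every window test whose line mass sits
  below the infrared height;
* `infrared_le_of_adversary` / `log_reach_ceiling`: ONE window test seen at level `η < L - Re ψ(1/4)`
  forces `κ_a |h|^{2k+2} ≤ η T₀^{2k}` and, through the margin condition and Stirling on `Re s = 1/4`,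
  `(2k+2)(log 2 + L + c - K(1/4)) ≤ log η - log κ_a + 2k log T₀` — the infrared height `2e^{L+c-K}`
  lies below `(η/κ_a)^{1/(2k+2)} T₀^{k/(k+1)}`.
Every window test is such an adversary at level `C_g²(W_{T₀} + c/(2(1+h²)))/‖g‖₂²`
(`HandoffWindowTestLevel`).  For THEOREM V (`2S(log q⁺) ≈ 4√q⁺`) this is the RH-free CEILING
`2S(2a+δ) + c ≤ (k/(k+1)) log T₀ + O(1)`, the other side of the achievability law of ATTEMPT-15 §4.4:
the reach of the zero-side line in `q⁺ = e^{2a}` is doubly logarithmic in `T₀` from both sides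
(paper: handoff/prove-1 ATTEMPT-19).  Nothing here bears on the truth of RH: every statement is about
the hypotheses of a conditional certificate.
-/

set_option linter.dupNamespace false  -- the mandated namespace repeats `RiemannHypothesis`

open scoped Real
open Complex MeasureTheory Set Filter Literature.NumberTheory.LFunctions
  Literature.Analysis.SpecialFunctions

namespace Summit.RiemannHypothesis.RiemannHypothesis.Theorems

variable {g φ : ℝ → ℂ} {a δ : ℝ}

/-! ### LEMMA R1: the high mass against the band below the infrared height -/

/-- The line mass below `|h|` is at most `‖g‖₂²` (Plancherel). -/
theorem band_le_weilNorm2Sq (hg : IsWeilTest g) (h : ℝ) :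
    (2 * π)⁻¹ * ∫ t in Ioo (-|h|) |h|, ‖weilMellin g (1 / 2 + t * I)‖ ^ 2 ≤ weilNorm2Sq g := by
  have hfi := integrable_norm_sq_weilMellin_half_line hg
  have hπ : (0 : ℝ) < 2 * π := by positivity
  have h1 : ∫ t in Ioo (-|h|) |h|, ‖weilMellin g (1 / 2 + t * I)‖ ^ 2 ≤
      ∫ t : ℝ, ‖weilMellin g (1 / 2 + t * I)‖ ^ 2 :=
    setIntegral_le_integral hfi (Eventually.of_forall fun t ↦ sq_nonneg _)
  rw [integral_norm_sq_weilMellin_half_line hg] at h1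
  calc (2 * π)⁻¹ * ∫ t in Ioo (-|h|) |h|, ‖weilMellin g (1 / 2 + t * I)‖ ^ 2
      ≤ (2 * π)⁻¹ * (2 * π * weilNorm2Sq g) := mul_le_mul_of_nonneg_left h1 (by positivity)
    _ = weilNorm2Sq g := by field_simp

/-- The line mass beyond `|h|`, `‖g‖₂² - B_h(g)`, is `(2π)⁻¹ ∫_{|t| ≥ |h|} |ĝ(1/2+it)|²`. -/
theorem weilNorm2Sq_sub_band_eq (hg : IsWeilTest g) (h : ℝ) :
    weilNorm2Sq g - (2 * π)⁻¹ * ∫ t in Ioo (-|h|) |h|, ‖weilMellin g (1 / 2 + t * I)‖ ^ 2 =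
      (2 * π)⁻¹ * ∫ t in (Ioo (-|h|) |h|)ᶜ, ‖weilMellin g (1 / 2 + t * I)‖ ^ 2 := by
  have hfi := integrable_norm_sq_weilMellin_half_line hg
  have hπ : (0 : ℝ) < 2 * π := by positivity
  have hsplit := integral_add_compl (μ := volume) measurableSet_Ioo hfi (s := Ioo (-|h|) |h|)
  rw [integral_norm_sq_weilMellin_half_line hg] at hsplit
  have : weilNorm2Sq g = (2 * π)⁻¹ * ((∫ t in Ioo (-|h|) |h|, ‖weilMellin g (1 / 2 + t * I)‖ ^ 2) +
      ∫ t in (Ioo (-|h|) |h|)ᶜ, ‖weilMellin g (1 / 2 + t * I)‖ ^ 2) := by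
    rw [hsplit]; field_simp
  rw [this]; ring

/-- **LEMMA R1.** If `1 - Φ(t) ≤ θ` for `|t| < |h|` then
`M_φ(g) ≤ θ · B_h(g) + (‖g‖₂² - B_h(g))`, `B_h(g) = (2π)⁻¹ ∫_{|t|<|h|} |ĝ(1/2+it)|²`: inside the band the
high density is at most `θ |ĝ|²`, outside at most `|ĝ|²`. -/
theorem highMassK_le_band_add_tail (hg : IsWeilTest g) (hφ : IsSplitKernel φ δ) {h θ : ℝ}
    (hθ : ∀ t : ℝ, |t| < |h| → 1 - lineSymbol φ t ≤ θ) :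
    highMassK g φ ≤ θ * ((2 * π)⁻¹ * ∫ t in Ioo (-|h|) |h|, ‖weilMellin g (1 / 2 + t * I)‖ ^ 2) +
      (weilNorm2Sq g - (2 * π)⁻¹ * ∫ t in Ioo (-|h|) |h|, ‖weilMellin g (1 / 2 + t * I)‖ ^ 2) := by
  set f : ℝ → ℝ := fun t ↦ ‖weilMellin g (1 / 2 + t * I)‖ ^ 2 with hf
  set S : Set ℝ := Ioo (-|h|) |h| with hS
  have hfi : Integrable f := integrable_norm_sq_weilMellin_half_line hg
  have hui : Integrable (highDensityK g φ) := integrable_highDensityK hg hφ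
  have hπ : (0 : ℝ) < 2 * π := by positivity
  have hmS : MeasurableSet S := measurableSet_Ioo
  -- inside the band
  have hin : ∫ t in S, highDensityK g φ t ≤ θ * ∫ t in S, f t := by
    have hpt : ∀ t ∈ S, highDensityK g φ t ≤ θ * f t := by
      intro t ht
      have hth : |t| < |h| := abs_lt.2 ⟨ht.1, ht.2⟩
      have h3 := hθ t hth
      have hf0 : 0 ≤ f t := sq_nonneg _
      unfold highDensityK
      calc ‖weilMellin g (1 / 2 + t * I)‖ ^ 2 * (1 - lineSymbol φ t)
          ≤ f t * θ := mul_le_mul_of_nonneg_left h3 hf0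
        _ = θ * f t := by ring
    calc ∫ t in S, highDensityK g φ t ≤ ∫ t in S, θ * f t :=
          setIntegral_mono_on hui.integrableOn (hfi.const_mul _).integrableOn hmS hpt
      _ = θ * ∫ t in S, f t := integral_const_mul _ _
  -- outside the band
  have hout : ∫ t in Sᶜ, highDensityK g φ t ≤ ∫ t in Sᶜ, f t :=
    setIntegral_mono_on hui.integrableOn hfi.integrableOn hmS.compl
      (fun t _ ↦ (highDensityK_bounds hφ g t).2)
  have hsplitu := integral_add_compl (μ := volume) hmS hui
  have htail := weilNorm2Sq_sub_band_eq hg h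
  rw [← hS] at htail
  have hM : highMassK g φ = (2 * π)⁻¹ * ((∫ t in S, highDensityK g φ t) +
      ∫ t in Sᶜ, highDensityK g φ t) := by
    rw [highMassK, hsplitu]
  rw [hM, htail]
  have hinv : 0 ≤ (2 * π)⁻¹ := by positivity
  nlinarith [mul_le_mul_of_nonneg_left hin hinv, mul_le_mul_of_nonneg_left hout hinv]

/-! ### LEMMA R2: transparency below `|h|` against strip decay -/

/-- Transparency extends to the closed band: `1 - Φ(t) ≤ θ` for `|t| ≤ |h|` (`Φ` is continuous),
provided `h ≠ 0`. -/
theorem one_sub_lineSymbol_le_of_abs_le (hφ : IsSplitKernel φ δ) {h θ : ℝ} (hh : h ≠ 0)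
    (hθ : ∀ t : ℝ, |t| < |h| → 1 - lineSymbol φ t ≤ θ) {t : ℝ} (ht : |t| ≤ |h|) :
    1 - lineSymbol φ t ≤ θ := by
  have hclosed : IsClosed {u : ℝ | 1 - lineSymbol φ u ≤ θ} :=
    isClosed_le (continuous_const.sub hφ.continuous_lineSymbol) continuous_const
  have hsub : Ioo (-|h|) |h| ⊆ {u : ℝ | 1 - lineSymbol φ u ≤ θ} :=
    fun u hu ↦ hθ u (abs_lt.2 ⟨hu.1, hu.2⟩)
  have hne : -|h| ≠ |h| := by
    have : 0 < |h| := abs_pos.2 hh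
    linarith
  have hcl : Icc (-|h|) |h| ⊆ {u : ℝ | 1 - lineSymbol φ u ≤ θ} := by
    rw [← closure_Ioo hne]
    exact hclosed.closure_subset_iff.2 hsub
  exact hcl (abs_le.1 ht)

/-- **LEMMA R2.** Transparency `1 - Φ ≤ θ` below `|h|` and strip decay
`‖φ̂(ρ)‖ ≤ D²/|Im ρ|^{2k+2}` force `(1 - θ) |h|^{2k+2} ≤ D²` (evaluate both at `ρ = 1/2 + i|h|`:
`1 - θ ≤ Φ(|h|) = Re φ̂ ≤ ‖φ̂‖ ≤ D²/|h|^{2k+2}`). -/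
theorem sq_strip_decay_ge_of_transparency (hφ : IsSplitKernel φ δ) {h θ D : ℝ} {k : ℕ}
    (hθ : ∀ t : ℝ, |t| < |h| → 1 - lineSymbol φ t ≤ θ)
    (hD : ∀ ρ : ℂ, 0 ≤ ρ.re → ρ.re ≤ 1 → ρ.im ≠ 0 →
      ‖weilMellin φ ρ‖ ≤ D ^ 2 / |ρ.im| ^ (2 * (k + 1))) :
    (1 - θ) * |h| ^ (2 * (k + 1)) ≤ D ^ 2 := by
  by_cases hh : h = 0
  · rw [hh, abs_zero, zero_pow (by omega), mul_zero]; exact sq_nonneg D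
  have hpos : 0 < |h| := abs_pos.2 hh
  have hpow : 0 < |h| ^ (2 * (k + 1)) := pow_pos hpos _
  have h1 : 1 - lineSymbol φ |h| ≤ θ := one_sub_lineSymbol_le_of_abs_le hφ hh hθ (by rw [abs_abs])
  set ρ : ℂ := 1 / 2 + (|h| : ℝ) * I with hρ
  have hre : ρ.re = 1 / 2 := by simp [hρ]
  have him : ρ.im = |h| := by simp [hρ]
  have h2 := hD ρ (by rw [hre]; norm_num) (by rw [hre]; norm_num) (by rw [him]; exact hpos.ne')
  rw [him, abs_abs] at h2
  have h3 : lineSymbol φ |h| ≤ ‖weilMellin φ ρ‖ := Complex.re_le_norm _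
  have h4 : 1 - θ ≤ D ^ 2 / |h| ^ (2 * (k + 1)) := by linarith
  rwa [le_div_iff₀ hpow] at h4

/-- **The tariff floor.** Under transparency and strip decay (`θ ≤ 1`),
`κ_a (1-θ) |h|^{2k+2}/T₀^{2k} + (W_h - W_0) θ + 4 p a e^a ≤ τ_φ`, `κ_a = 8 log 2 · A₁ · a e^a`. -/
theorem splitTariff_ge_floor (hφ : IsSplitKernel φ δ) (ha : 0 ≤ a) {T₀ h θ p D : ℝ} {k : ℕ}
    (hT₀ : 0 < T₀) (hθ : ∀ t : ℝ, |t| < |h| → 1 - lineSymbol φ t ≤ θ)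
    (hD : ∀ ρ : ℂ, 0 ≤ ρ.re → ρ.re ≤ 1 → ρ.im ≠ 0 →
      ‖weilMellin φ ρ‖ ≤ D ^ 2 / |ρ.im| ^ (2 * (k + 1))) :
    8 * Real.log 2 * zetaDensityConst * a * Real.exp a * ((1 - θ) * |h| ^ (2 * (k + 1))) / T₀ ^ (2 * k)
      + (reDigammaQuarter h - reDigammaQuarter 0) * θ + 4 * p * a * Real.exp a ≤
      splitTariff a T₀ h θ p D k := by
  have h1 := sq_strip_decay_ge_of_transparency hφ hθ hD
  have hA₁ := zetaDensityConst_pos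
  have hl2 : 0 ≤ Real.log 2 := Real.log_nonneg (by norm_num)
  have hc₁ : 0 ≤ 8 * Real.log 2 * zetaDensityConst * a * Real.exp a := by positivity
  have hT : 0 < T₀ ^ (2 * k) := pow_pos hT₀ _
  unfold splitTariff
  have := div_le_div_of_nonneg_right (mul_le_mul_of_nonneg_left h1 hc₁) hT.le
  linarith

/-! ### THEOREM R: the reach inequality -/

/-- THEOREM R for `θ ≤ 1`, from the near-null sampling inequality at ONE window test `g`. -/
theorem reach_inequality_of_le_one (hg : IsWeilTest g) (hφ : IsSplitKernel φ δ) (ha : 0 ≤ a)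
    {T₀ h c θ p D L : ℝ} {k : ℕ} (hT₀ : 0 < T₀) (hθ0 : 0 ≤ θ) (hθ1 : θ ≤ 1)
    (hθ : ∀ t : ℝ, |t| < |h| → 1 - lineSymbol φ t ≤ θ) (hp : 0 ≤ p) (hc : 0 ≤ c)
    (hD : ∀ ρ : ℂ, 0 ≤ ρ.re → ρ.re ≤ 1 → ρ.im ≠ 0 →
      ‖weilMellin φ ρ‖ ≤ D ^ 2 / |ρ.im| ^ (2 * (k + 1)))
    (hL : L + c ≤ reDigammaQuarter h)
    (hNNSg : splitTariff a T₀ h θ p D k * weilNorm2Sq g ≤ verifiedGramK g φ T₀ + c * highMassK g φ) :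
    min (8 * Real.log 2 * zetaDensityConst * a * Real.exp a * |h| ^ (2 * (k + 1)) / T₀ ^ (2 * k))
        (L - reDigammaQuarter 0) * weilNorm2Sq g ≤
      verifiedGramK g φ T₀ +
        c * (weilNorm2Sq g - (2 * π)⁻¹ * ∫ t in Ioo (-|h|) |h|, ‖weilMellin g (1 / 2 + t * I)‖ ^ 2) := by
  set N := weilNorm2Sq g with hN
  set B := (2 * π)⁻¹ * ∫ t in Ioo (-|h|) |h|, ‖weilMellin g (1 / 2 + t * I)‖ ^ 2 with hB
  set κ := 8 * Real.log 2 * zetaDensityConst * a * Real.exp a with hκ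
  set X := κ * |h| ^ (2 * (k + 1)) / T₀ ^ (2 * k) with hX
  set m := L - reDigammaQuarter 0 with hm
  have hN0 : 0 ≤ N := weilNorm2Sq_nonneg g
  have hBN : B ≤ N := band_le_weilNorm2Sq hg h
  have hM := highMassK_le_band_add_tail hg hφ hθ
  have hfloor := splitTariff_ge_floor hφ ha hT₀ hθ hD (p := p)
  have hA₁ := zetaDensityConst_pos
  have hl2 : 0 ≤ Real.log 2 := Real.log_nonneg (by norm_num)
  have hκ0 : 0 ≤ κ := by positivity
  have hT : 0 < T₀ ^ (2 * k) := pow_pos hT₀ _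
  have hX0 : 0 ≤ X := by positivity
  have hWw : reDigammaQuarter 0 ≤ reDigammaQuarter h := reDigammaQuarter_zero_le h
  -- the floor, rewritten with `X`
  have hfloor' : X * (1 - θ) + (reDigammaQuarter h - reDigammaQuarter 0) * θ + 4 * p * a * Real.exp a ≤
      splitTariff a T₀ h θ p D k := by
    have e : κ * ((1 - θ) * |h| ^ (2 * (k + 1))) / T₀ ^ (2 * k) = X * (1 - θ) := by
      rw [hX]; ring
    linarith [hfloor]
  -- NNS at `g`, with `M ≤ θ B + (N - B) ≤ θ N + (N - B)`
  have hcM : c * highMassK g φ ≤ c * θ * N + c * (N - B) := by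
    have h1 : highMassK g φ ≤ θ * N + (N - B) := by
      have : θ * B ≤ θ * N := mul_le_mul_of_nonneg_left hBN hθ0
      linarith
    nlinarith
  have hmain : (X * (1 - θ) + (reDigammaQuarter h - reDigammaQuarter 0 - c) * θ
      + 4 * p * a * Real.exp a) * N ≤ verifiedGramK g φ T₀ + c * (N - B) := by
    have := mul_le_mul_of_nonneg_right hfloor' hN0
    nlinarith
  -- the margin condition makes the `θ`-coefficient at least `m`
  have hcoef : min X m ≤ X * (1 - θ) + (reDigammaQuarter h - reDigammaQuarter 0 - c) * θ
      + 4 * p * a * Real.exp a := by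
    have h1 : min X m ≤ X := min_le_left _ _
    have h2 : min X m ≤ m := min_le_right _ _
    have h3 : m ≤ reDigammaQuarter h - reDigammaQuarter 0 - c := by rw [hm]; linarith
    have h4 : 0 ≤ 4 * p * a * Real.exp a := by positivity
    nlinarith [mul_le_mul_of_nonneg_right h1 (sub_nonneg.2 hθ1), mul_le_mul_of_nonneg_right h2 hθ0,
      mul_le_mul_of_nonneg_right h3 hθ0]
  calc min X m * N ≤ (X * (1 - θ) + (reDigammaQuarter h - reDigammaQuarter 0 - c) * θ
        + 4 * p * a * Real.exp a) * N := mul_le_mul_of_nonneg_right hcoef hN0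
    _ ≤ verifiedGramK g φ T₀ + c * (N - B) := hmain

/-- **THEOREM R (the reach inequality).** Let `φ` be a split kernel with transparency `θ ≥ 0` below
`|h|`, polar defect `p ≥ 0`, strip decay `(D, k)`, and let the margin `c ≥ 0` satisfy `L + c ≤ Re ψ(1/4+ih/2)`.
If `NearNullSamplingK a φ T₀ h c θ p D k` holds then EVERY window test `g` on `[-a, a]` satisfies
`min(κ_a |h|^{2k+2}/T₀^{2k}, L - Re ψ(1/4)) · ‖g‖₂² ≤ 𝒱_φ(g) + c · (‖g‖₂² - B_h(g))`
(`κ_a = 8 log 2 · A₁ · a e^a`, `B_h(g)` the line mass below `|h|`).  No hypothesis on the zeros of `ζ`. -/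
theorem reach_inequality (hg : IsWeilTest g) (hsupp : tsupport g ⊆ Icc (-a) a) (ha : 0 ≤ a)
    (hφ : IsSplitKernel φ δ) {T₀ h c θ p D L : ℝ} {k : ℕ} (hT₀ : 0 < T₀) (hθ0 : 0 ≤ θ)
    (hθ : ∀ t : ℝ, |t| < |h| → 1 - lineSymbol φ t ≤ θ) (hp : 0 ≤ p) (hc : 0 ≤ c)
    (hD : ∀ ρ : ℂ, 0 ≤ ρ.re → ρ.re ≤ 1 → ρ.im ≠ 0 →
      ‖weilMellin φ ρ‖ ≤ D ^ 2 / |ρ.im| ^ (2 * (k + 1)))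
    (hL : L + c ≤ reDigammaQuarter h) (hNNS : NearNullSamplingK a φ T₀ h c θ p D k) :
    min (8 * Real.log 2 * zetaDensityConst * a * Real.exp a * |h| ^ (2 * (k + 1)) / T₀ ^ (2 * k))
        (L - reDigammaQuarter 0) * weilNorm2Sq g ≤
      verifiedGramK g φ T₀ +
        c * (weilNorm2Sq g - (2 * π)⁻¹ * ∫ t in Ioo (-|h|) |h|, ‖weilMellin g (1 / 2 + t * I)‖ ^ 2) := by
  have hNNSg := hNNS g hg hsupp
  by_cases hθ1 : θ ≤ 1
  · exact reach_inequality_of_le_one hg hφ ha hT₀ hθ0 hθ1 hθ hp hc hD hL hNNSg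
  -- `θ > 1`: the tariff only grows with `θ`, and transparency with `θ = 1` is automatic
  have hθ' : ∀ t : ℝ, |t| < |h| → 1 - lineSymbol φ t ≤ 1 := fun t _ ↦ by
    have := hφ.line_nonneg t
    unfold lineSymbol; linarith
  have hmono : splitTariff a T₀ h 1 p D k ≤ splitTariff a T₀ h θ p D k := by
    unfold splitTariff
    have hWw : 0 ≤ reDigammaQuarter h - reDigammaQuarter 0 := by
      linarith [reDigammaQuarter_zero_le h]
    nlinarith [not_le.1 hθ1]
  have hNNSg' : splitTariff a T₀ h 1 p D k * weilNorm2Sq g ≤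
      verifiedGramK g φ T₀ + c * highMassK g φ :=
    (mul_le_mul_of_nonneg_right hmono (weilNorm2Sq_nonneg g)).trans hNNSg
  exact reach_inequality_of_le_one hg hφ ha hT₀ zero_le_one le_rfl hθ' hp hc hD hL hNNSg'

/-! ### Corollaries: the infrared height is below the verified height -/

/-- **COROLLARY R-A.** If ONE window test `g` (`‖g‖₂ > 0`) is seen by the certificate's form at level
`η < L - Re ψ(1/4)`, i.e. `𝒱_φ(g) + c(‖g‖₂² - B_h(g)) ≤ η ‖g‖₂²`, then `κ_a |h|^{2k+2}/T₀^{2k} ≤ η`. -/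
theorem infrared_le_of_adversary (hg : IsWeilTest g) (hsupp : tsupport g ⊆ Icc (-a) a) (ha : 0 ≤ a)
    (hφ : IsSplitKernel φ δ) {T₀ h c θ p D L η : ℝ} {k : ℕ} (hT₀ : 0 < T₀) (hθ0 : 0 ≤ θ)
    (hθ : ∀ t : ℝ, |t| < |h| → 1 - lineSymbol φ t ≤ θ) (hp : 0 ≤ p) (hc : 0 ≤ c)
    (hD : ∀ ρ : ℂ, 0 ≤ ρ.re → ρ.re ≤ 1 → ρ.im ≠ 0 →
      ‖weilMellin φ ρ‖ ≤ D ^ 2 / |ρ.im| ^ (2 * (k + 1)))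
    (hL : L + c ≤ reDigammaQuarter h) (hNNS : NearNullSamplingK a φ T₀ h c θ p D k)
    (hN : 0 < weilNorm2Sq g) (hηm : η < L - reDigammaQuarter 0)
    (hη : verifiedGramK g φ T₀ +
        c * (weilNorm2Sq g - (2 * π)⁻¹ * ∫ t in Ioo (-|h|) |h|, ‖weilMellin g (1 / 2 + t * I)‖ ^ 2)
        ≤ η * weilNorm2Sq g) :
    8 * Real.log 2 * zetaDensityConst * a * Real.exp a * |h| ^ (2 * (k + 1)) / T₀ ^ (2 * k) ≤ η := by
  have h1 := reach_inequality hg hsupp ha hφ hT₀ hθ0 hθ hp hc hD hL hNNS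
  set X := 8 * Real.log 2 * zetaDensityConst * a * Real.exp a * |h| ^ (2 * (k + 1)) / T₀ ^ (2 * k)
  have h2 : min X (L - reDigammaQuarter 0) ≤ η := le_of_mul_le_mul_right (h1.trans hη) hN
  rcases le_total X (L - reDigammaQuarter 0) with hle | hle
  · rwa [min_eq_left hle] at h2
  · rw [min_eq_right hle] at h2; linarith

/-- `Re ψ(1/4 + it/2) ≤ log(|t|/2) + K(1/4)` for `|t| ≥ 2`, with `K(1/4) = stirlingVertRate (1/4) < 0.6`
(Stirling on the vertical line `Re s = 1/4`, `abs_re_digamma_vertical_sub_log_le`, and evenness in `t`). -/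
theorem reDigammaQuarter_le_log_half_add (t : ℝ) (ht : 2 ≤ |t|) :
    reDigammaQuarter t ≤ Real.log (|t| / 2) + stirlingVertRate (1 / 4) := by
  have hK : 0 ≤ stirlingVertRate (1 / 4) := by unfold stirlingVertRate; positivity
  have hu : 1 ≤ |t| / 2 := by linarith
  have h := abs_re_digamma_vertical_sub_log_le (σ := 1 / 4) (u := |t| / 2) (by norm_num) hu
  have hdiv : stirlingVertRate (1 / 4) / (|t| / 2) ^ 2 ≤ stirlingVertRate (1 / 4) :=
    div_le_self hK (by nlinarith)
  have heq : reDigammaQuarter t = (Complex.digamma ((((1 / 4 : ℝ)) : ℂ) + ((|t| / 2 : ℝ) : ℂ) * I)).re := by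
    rw [← reDigammaQuarter_even, show reDigammaQuarter (-t) = reDigammaQuarter |t| from by
      rcases le_or_gt 0 t with h0 | h0
      · rw [abs_of_nonneg h0, reDigammaQuarter_even]
      · rw [abs_of_neg h0]]
    rw [reDigammaQuarter]
    congr 2; push_cast; ring
  rw [heq]
  have := (abs_le.1 (h.trans hdiv)).2
  linarith

/-- Under the margin condition with `L ≥ log π` and `c ≥ 0` the infrared height satisfies `|h| > 2`
(`Re ψ(1/4 + it/2) ≤ K(1/4) < 1 < log π` for `|t| ≤ 2`). -/
theorem two_lt_abs_infrared {h c L : ℝ} (hc : 0 ≤ c) (hLπ : Real.log π ≤ L)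
    (hL : L + c ≤ reDigammaQuarter h) : 2 < |h| := by
  by_contra hle
  rw [not_lt] at hle
  have h2 : reDigammaQuarter h ≤ reDigammaQuarter 2 :=
    reDigammaQuarter_mono (by rw [abs_two]; exact hle)
  have h3 : reDigammaQuarter 2 ≤ Real.log (|(2 : ℝ)| / 2) + stirlingVertRate (1 / 4) :=
    reDigammaQuarter_le_log_half_add 2 (by rw [abs_two])
  rw [abs_two, div_self two_ne_zero, Real.log_one, zero_add] at h3
  have h4 : stirlingVertRate (1 / 4) < 1 := by
    unfold stirlingVertRate; nlinarith [Real.pi_lt_d2]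
  linarith [one_lt_log_pi]

/-- **COROLLARY R-B (the reach ceiling, logarithmic form).** Under the hypotheses of THEOREM R with
`L ≥ log π`, one window test seen at a level `0 < η < L - Re ψ(1/4)` forces
`(2k+2) · (log 2 + L + c - K(1/4)) ≤ log η - log κ_a + 2k · log T₀`:
the infrared height `2 e^{L + c - K}` lies below `(η/κ_a)^{1/(2k+2)} T₀^{k/(k+1)}`. -/
theorem log_reach_ceiling (hg : IsWeilTest g) (hsupp : tsupport g ⊆ Icc (-a) a) (ha : 0 < a)
    (hφ : IsSplitKernel φ δ) {T₀ h c θ p D L η : ℝ} {k : ℕ} (hT₀ : 0 < T₀) (hθ0 : 0 ≤ θ)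
    (hθ : ∀ t : ℝ, |t| < |h| → 1 - lineSymbol φ t ≤ θ) (hp : 0 ≤ p) (hc : 0 ≤ c)
    (hD : ∀ ρ : ℂ, 0 ≤ ρ.re → ρ.re ≤ 1 → ρ.im ≠ 0 →
      ‖weilMellin φ ρ‖ ≤ D ^ 2 / |ρ.im| ^ (2 * (k + 1)))
    (hLπ : Real.log π ≤ L) (hL : L + c ≤ reDigammaQuarter h)
    (hNNS : NearNullSamplingK a φ T₀ h c θ p D k)
    (hN : 0 < weilNorm2Sq g) (hη0 : 0 < η) (hηm : η < L - reDigammaQuarter 0)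
    (hη : verifiedGramK g φ T₀ +
        c * (weilNorm2Sq g - (2 * π)⁻¹ * ∫ t in Ioo (-|h|) |h|, ‖weilMellin g (1 / 2 + t * I)‖ ^ 2)
        ≤ η * weilNorm2Sq g) :
    (2 * k + 2) * (Real.log 2 + L + c - stirlingVertRate (1 / 4)) ≤
      Real.log η - Real.log (8 * Real.log 2 * zetaDensityConst * a * Real.exp a)
        + 2 * k * Real.log T₀ := by
  set κ := 8 * Real.log 2 * zetaDensityConst * a * Real.exp a with hκ
  have hA₁ := zetaDensityConst_pos
  have hl2 : 0 < Real.log 2 := Real.log_pos (by norm_num)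
  have hκ0 : 0 < κ := by positivity
  have hX := infrared_le_of_adversary hg hsupp ha.le hφ hT₀ hθ0 hθ hp hc hD hL hNNS hN hηm hη
  have hh2 := two_lt_abs_infrared hc hLπ hL
  have hhpos : 0 < |h| := by linarith
  -- `L + c ≤ log(|h|/2) + K`, i.e. `2 e^{L+c-K} ≤ |h|`
  have hW := (hL.trans (reDigammaQuarter_le_log_half_add h hh2.le))
  have hlogh : Real.log 2 + L + c - stirlingVertRate (1 / 4) ≤ Real.log |h| := by
    have : Real.log (|h| / 2) = Real.log |h| - Real.log 2 :=
      Real.log_div hhpos.ne' two_ne_zero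
    linarith
  -- logarithm of `κ |h|^{2k+2} ≤ η T₀^{2k}`
  have hT : 0 < T₀ ^ (2 * k) := pow_pos hT₀ _
  have hX' : κ * |h| ^ (2 * (k + 1)) ≤ η * T₀ ^ (2 * k) := by
    rwa [div_le_iff₀ hT] at hX
  have hlog := Real.log_le_log (by positivity) hX'
  rw [Real.log_mul hκ0.ne' (pow_pos hhpos _).ne', Real.log_mul hη0.ne' hT.ne', Real.log_pow,
    Real.log_pow] at hlog
  push_cast at hlog
  have : (2 * (k : ℝ) + 2) * Real.log |h| = (2 * ((k : ℝ) + 1)) * Real.log |h| := by ring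
  have hk0 : (0 : ℝ) ≤ 2 * k + 2 := by positivity
  nlinarith [mul_le_mul_of_nonneg_left hlogh hk0]

end Summit.RiemannHypothesis.RiemannHypothesis.Theorems
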